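import Summits.CriticalPhenomena.PercolationContinuityZ3.Theorems.PercNearOneGluingNoHeavyLowerTailTwoLevelLonelyRelayLoss
import Summits.CriticalPhenomena.PercolationContinuityZ3.Theorems.PercNearOneGluingNoHeavyLowerTailTwoLevelLonelyRelayGain
import Summits.CriticalPhenomena.PercolationContinuityZ3.Theorems.PercNearOneGluingNearOneGluingSingleFinger
import Summits.CriticalPhenomena.PercolationContinuityZ3.Theorems.PercNearOneGluingNearOneGluingWeightContinuity
import HarnessLib

/-!
# `NoHeavyLowerTail` (stmt-CriticalPhenomena-4575) — THE TWO-LEVEL LONELY RELAY THEOREM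
# (nested levels of candidate pockets do not add up), all `|A|`, unconditional

Support file (factory prove seat `prim-ineq-prove-3`, gen 3; `--supports stmt-CriticalPhenomena-4575`); no
definitions, no named facts.  For bond percolation with arbitrary edge probabilities on `Fin n`
(`μ = prodBernoulli w`), an observer `o`, a relay set `A` split into halves `B` and `A ∖ B`, designated singletons
`U ⊆ B`, `U' ⊆ A ∖ B`, and `S = C(o) ∩ A`:

  `μ(u ↮ A∖B) ≤ t (u ∈ U)`, `μ(u' ↮ B) ≤ t (u' ∈ U')`, `μ(B ↮ A∖B) ≤ t`  ⟹
  `μ( S = B ∨ S = A∖B ∨ S = {u}, u ∈ U ∪ U' ) ≤ t`                                  (`twoLevelLonelyRelay`)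

i.e. the laminar family `𝓛 = {B, A∖B} ∪ {{u}}` of candidate pockets carries AT MOST ONE cut budget: its two
levels (Kozma–Nitzan's Lemma 2 = `Theorems.lonelyRelay` / `Theorems.blockLonelyRelay` bounds each antichain by
`t` separately) do NOT add up.  Pairwise form `twoLevelLonelyRelay_of_pairs` (`μ(a ↮ a') ≤ t` for `a ≠ a'`), and
`twoLevelLonelyRelay_halves`: for EVERY bipartition of `A` into nonempty halves, `μ(N = 1 ∨ S = B ∨ S = A∖B) ≤ t`.
Equality: `o` glued to one relay, the other half glued (`k = 4`: harness rows P3-LAM2X / P3-LAM2W of the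
prim-ineq factory are this theorem with `|B| = |A∖B| = 2`).  WHY (FINDING-SCALES.md / FINDING-LAM.md of seat
prim-ineq-prove-3): the `log |A|` loss of the one-cut line (`Theorems.oneCut_logLoss`) is the possibility that
every dyadic level of a laminar pocket profile carries mass `t`; this theorem excludes it for the pair
(finest designated level, top bipartition), uniformly in `|A|`.

PROOF (Kozma–Nitzan's Theorem-1 weights, one level up).  `φ_u = P(o ↔ u | u ↮ A∖u)`; for each designated `u`,
`μ(u ↮ far u) − μ(Λ) = μ({u ↮ far u} ∩ Λᶜ) − μ(Λ ∩ {u ↔ far u}) ≥ Σ_{r≠u} φ_r [a(u,r) − a(r,u)]` with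
`a(u,r) = μ({u ↮ A∖u} ∩ {r ↔ far r})`, by the loss bound (`…Loss.lean`: two-set BHK negative correlation) and the
gain bound (`…Gain.lean`: rider lemma + Lemma 2 on realised crossing blocks); the φ-weighted sum of the right-hand
sides vanishes by antisymmetry, so `(Σφ_u) μ(Λ) ≤ Σ φ_u μ(u ↮ far u) ≤ (Σφ_u) t` (`twoLevel_pos`, for weights
`< 1` so that all separation events are non-null; `Σφ_u = 0` is handled directly); weight continuity
(`stub_weightContinuity`) removes the positivity (`twoLevel_far`).
-/

namespace Summit.CriticalPhenomena.PercolationContinuityZ3.Theorems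

open scoped BigOperators Classical Topology
open MeasureTheory Set Filter
open Literature.Probability.LatticeModels (prodBernoulli)
open Literature.Probability.Percolation

variable {n : ℕ}

namespace TwoLevelLonelyRelay

/-- **Two-level lonely relay, non-null separation** (steps (c)–(d)).  With designated singletons `L`, far sides
`far`, all relays pairwise separated with positive probability, `μ(u ↮ far u) ≤ t` for `u ∈ L` and
`μ(B ↮ A∖B) ≤ t`:  `μ(Λ) ≤ t`, `Λ = {C(o)∩A = B} ∪ {C(o)∩A = A∖B} ∪ ⋃_{u∈L} {C(o)∩A = {u}}`.
Proof: `Σ_u φ_u (μ(u ↮ far u) − μ(Λ)) ≥ Σ_u Σ_{r≠u} φ_uφ_r [a(u,r) − a(r,u)] = 0` by `loss_le`, `gain_ge`.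
[cite: KozmaNitzan2024, Lemma 2 (p. 6) and Theorem 1 (p. 7) — the weights; this file] -/
theorem twoLevel_pos (w : Sym2 (Fin n) → unitInterval) (A B L : Finset (Fin n)) (far : Fin n → Finset (Fin n))
    (o : Fin n) (t : ℝ) (hBA : B ⊆ A)
    (hL : ∀ r ∈ L, (r ∈ B ∧ far r = A \ B) ∨ (r ∈ A \ B ∧ far r = B))
    (hpos : 0 < (prodBernoulli w).real
      {ω : BondConfig (Fin n) | ∀ x ∈ A, ∀ y ∈ A, x ≠ y → ω ∉ openConn x y})
    (hK : ∀ u ∈ L, (prodBernoulli w).real {ω | ∀ b ∈ far u, ω ∉ openConn u b} ≤ t)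
    (hBB : (prodBernoulli w).real {ω | ∀ b ∈ B, ∀ b' ∈ A \ B, ω ∉ openConn b b'} ≤ t) :
    (prodBernoulli w).real {ω | A.filter (fun a => ω ∈ openConn o a) = B ∨
        A.filter (fun a => ω ∈ openConn o a) = A \ B ∨
        ∃ r ∈ L, A.filter (fun a => ω ∈ openConn o a) = {r}} ≤ t := by
  set μ := prodBernoulli w with hμ
  set Λ : Set (BondConfig (Fin n)) := {ω | A.filter (fun a => ω ∈ openConn o a) = B ∨
      A.filter (fun a => ω ∈ openConn o a) = A \ B ∨
      ∃ r ∈ L, A.filter (fun a => ω ∈ openConn o a) = {r}} with hΛ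
  set φ : Fin n → ℝ := fun r => μ.real ({ω | ∀ y ∈ A.erase r, ω ∉ openConn r y} ∩ openConn o r) /
    μ.real {ω | ∀ y ∈ A.erase r, ω ∉ openConn r y} with hφ
  set a : Fin n → Fin n → ℝ := fun u r =>
    μ.real ({ω | ∀ y ∈ A.erase u, ω ∉ openConn u y} ∩ {ω | ∃ b ∈ far r, ω ∈ openConn r b}) with ha
  set K : Fin n → Set (BondConfig (Fin n)) := fun u => {ω | ∀ b ∈ far u, ω ∉ openConn u b} with hKdef
  have hφ0 : ∀ r, 0 ≤ φ r := fun r => div_nonneg measureReal_nonneg measureReal_nonneg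
  -- (c) per designated singleton
  have hc : ∀ u ∈ L, (∑ r ∈ L.erase u, φ r * a u r) - (∑ r ∈ L.erase u, φ r * a r u) ≤
      μ.real (K u) - μ.real Λ := by
    intro u hu
    have gain := gain_ge w A B L far o u hBA hL hu hpos
    have loss := loss_le w A B L far o u hBA hL hu hpos
    have hKc : (K u)ᶜ = {ω | ∃ b ∈ far u, ω ∈ openConn u b} := by
      ext ω; simp only [hKdef, Set.mem_compl_iff, Set.mem_setOf_eq, not_forall, not_not, exists_prop]
    have e1 := measureReal_inter_add_sdiff (μ := μ) (s := K u) (t := Λ) MeasurableSet.of_discrete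
      (measure_ne_top _ _)
    have e2 := measureReal_inter_add_sdiff (μ := μ) (s := Λ) (t := K u) MeasurableSet.of_discrete
      (measure_ne_top _ _)
    rw [Set.sdiff_eq] at e1 e2
    rw [hKc] at e2
    rw [Set.inter_comm Λ (K u)] at e2
    have hg : ∑ r ∈ L.erase u, φ r * a u r ≤ μ.real (K u ∩ Λᶜ) := gain
    have hl : μ.real (Λ ∩ {ω | ∃ b ∈ far u, ω ∈ openConn u b}) ≤ ∑ r ∈ L.erase u, φ r * a r u := loss
    linarith
  -- the antisymmetric double sum vanishes
  have hswap : ∑ u ∈ L, φ u * ∑ r ∈ L.erase u, φ r * a r u = ∑ u ∈ L, φ u * ∑ r ∈ L.erase u, φ r * a u r := by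
    simp_rw [Finset.mul_sum]
    rw [Finset.sum_comm' (t' := L) (s' := fun r => L.erase r)]
    · refine Finset.sum_congr rfl fun r _ => Finset.sum_congr rfl fun u _ => by ring
    · intro u r
      simp only [Finset.mem_erase]
      constructor
      · rintro ⟨huL, hru, hrL⟩; exact ⟨⟨fun h => hru h.symm, huL⟩, hrL⟩
      · rintro ⟨⟨hur, huL⟩, hrL⟩; exact ⟨huL, fun h => hur h.symm, hrL⟩
  have hmain : (∑ u ∈ L, φ u) * μ.real Λ ≤ ∑ u ∈ L, φ u * μ.real (K u) := by
    have h1 : ∑ u ∈ L, φ u * ((∑ r ∈ L.erase u, φ r * a u r) - (∑ r ∈ L.erase u, φ r * a r u)) ≤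
        ∑ u ∈ L, φ u * (μ.real (K u) - μ.real Λ) :=
      Finset.sum_le_sum fun u hu => mul_le_mul_of_nonneg_left (hc u hu) (hφ0 u)
    have h2 : ∑ u ∈ L, φ u * ((∑ r ∈ L.erase u, φ r * a u r) - (∑ r ∈ L.erase u, φ r * a r u)) = 0 := by
      simp_rw [mul_sub, Finset.sum_sub_distrib]
      rw [hswap, sub_self]
    rw [h2] at h1
    simp_rw [mul_sub, Finset.sum_sub_distrib] at h1
    rw [Finset.sum_mul]
    have h3 : ∑ u ∈ L, φ u * μ.real Λ = ∑ i ∈ L, φ i * μ.real Λ := rfl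
    linarith
  have hKt : ∑ u ∈ L, φ u * μ.real (K u) ≤ (∑ u ∈ L, φ u) * t := by
    rw [Finset.sum_mul]
    exact Finset.sum_le_sum fun u hu => mul_le_mul_of_nonneg_left (hK u hu) (hφ0 u)
  -- (d) conclude
  by_cases hΦ : 0 < ∑ u ∈ L, φ u
  · exact le_of_mul_le_mul_left (hmain.trans hKt) hΦ
  · have hΦ0 : ∑ u ∈ L, φ u = 0 := le_antisymm (not_lt.1 hΦ) (Finset.sum_nonneg fun u _ => hφ0 u)
    have hφzero : ∀ u ∈ L, φ u = 0 := fun u hu =>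
      (Finset.sum_eq_zero_iff_of_nonneg fun u _ => hφ0 u).1 hΦ0 u hu
    have hx0 : ∀ u ∈ L, μ.real ({ω | ∀ y ∈ A.erase u, ω ∉ openConn u y} ∩ openConn o u) = 0 := by
      intro u hu
      have huA : u ∈ A := (far_facts A B L far hBA hL hu).1
      have hd : 0 < μ.real {ω | ∀ y ∈ A.erase u, ω ∉ openConn u y} := by
        refine lt_of_lt_of_le hpos (measureReal_mono fun ω hω y hy => ?_)
        exact hω u huA y (Finset.mem_erase.1 hy).2 (fun h => (Finset.mem_erase.1 hy).1 h.symm)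
      have := hφzero u hu
      rw [hφ] at this
      rcases (div_eq_zero_iff.1 this) with h | h
      · exact h
      · exact absurd h hd.ne'
    have hcover : Λ ⊆ {ω | A.filter (fun a => ω ∈ openConn o a) = B ∨
          A.filter (fun a => ω ∈ openConn o a) = A \ B} ∪
        ⋃ u ∈ L, {ω | A.filter (fun a => ω ∈ openConn o a) = {u}} := by
      rintro ω (hF | hF | ⟨r, hr, hF⟩)
      · exact Or.inl (Or.inl hF)
      · exact Or.inl (Or.inr hF)
      · exact Or.inr (Set.mem_iUnion₂.2 ⟨r, hr, hF⟩)
    calc μ.real Λ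
        ≤ μ.real ({ω | A.filter (fun a => ω ∈ openConn o a) = B ∨
              A.filter (fun a => ω ∈ openConn o a) = A \ B} ∪
            ⋃ u ∈ L, {ω | A.filter (fun a => ω ∈ openConn o a) = {u}}) :=
          measureReal_mono hcover (measure_ne_top _ _)
      _ ≤ μ.real {ω | A.filter (fun a => ω ∈ openConn o a) = B ∨
              A.filter (fun a => ω ∈ openConn o a) = A \ B} +
            μ.real (⋃ u ∈ L, {ω | A.filter (fun a => ω ∈ openConn o a) = {u}}) :=
          measureReal_union_le _ _
      _ ≤ μ.real {ω | ∀ b ∈ B, ∀ b' ∈ A \ B, ω ∉ openConn b b'} +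
            ∑ u ∈ L, μ.real {ω | A.filter (fun a => ω ∈ openConn o a) = {u}} :=
          add_le_add (measureReal_mono (roots_subset_sep A B hBA o) (measure_ne_top _ _))
            (measureReal_biUnion_finset_le _ _)
      _ ≤ t + ∑ u ∈ L, μ.real ({ω | ∀ y ∈ A.erase u, ω ∉ openConn u y} ∩ openConn o u) :=
          add_le_add hBB (Finset.sum_le_sum fun u _ =>
            measureReal_mono (filter_eq_singleton_subset A o u) (measure_ne_top _ _))
      _ = t := by rw [Finset.sum_eq_zero hx0, add_zero]

/-- **Two-level lonely relay with far sides, unconditional** (weight continuity removes the positivity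
hypothesis of `twoLevel_pos`: scale the weights by `1 − 1/(k+1)`, all `< 1`, and let `k → ∞`).
[cite: KozmaNitzan2024, Lemma 2 (p. 6); this file] -/
theorem twoLevel_far (w : Sym2 (Fin n) → unitInterval) (A B L : Finset (Fin n)) (far : Fin n → Finset (Fin n))
    (o : Fin n) (t : ℝ) (hBA : B ⊆ A)
    (hL : ∀ r ∈ L, (r ∈ B ∧ far r = A \ B) ∨ (r ∈ A \ B ∧ far r = B))
    (hK : ∀ u ∈ L, (prodBernoulli w).real {ω | ∀ b ∈ far u, ω ∉ openConn u b} ≤ t)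
    (hBB : (prodBernoulli w).real {ω | ∀ b ∈ B, ∀ b' ∈ A \ B, ω ∉ openConn b b'} ≤ t) :
    (prodBernoulli w).real {ω | A.filter (fun a => ω ∈ openConn o a) = B ∨
        A.filter (fun a => ω ∈ openConn o a) = A \ B ∨
        ∃ r ∈ L, A.filter (fun a => ω ∈ openConn o a) = {r}} ≤ t := by
  -- the scaled weights `w_k = (1 - 1/(k+1)) • w`, all `< 1`, converging to `w`
  have hcmem : ∀ k : ℕ, ((1 : ℝ) - 1 / ((k : ℝ) + 1)) ∈ unitInterval := by
    intro k
    have hk : (0 : ℝ) < (k : ℝ) + 1 := Nat.cast_add_one_pos k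
    have h1 : 1 / ((k : ℝ) + 1) ≤ 1 := by
      rw [div_le_one hk]; linarith [(Nat.cast_nonneg k : (0 : ℝ) ≤ k)]
    have h0 : 0 ≤ 1 / ((k : ℝ) + 1) := by positivity
    exact ⟨by linarith, by linarith⟩
  set wk : ℕ → Sym2 (Fin n) → unitInterval :=
    fun k e => ⟨(1 - 1 / ((k : ℝ) + 1)) * (w e : ℝ), unitInterval.mul_mem (hcmem k) (w e).2⟩
    with hwk_def
  have hwk_lt : ∀ k e, ((wk k e : unitInterval) : ℝ) < 1 := by
    intro k e
    have hc : (1 : ℝ) - 1 / ((k : ℝ) + 1) < 1 := by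
      have : 0 < 1 / ((k : ℝ) + 1) := by positivity
      linarith
    calc ((wk k e : unitInterval) : ℝ) = (1 - 1 / ((k : ℝ) + 1)) * (w e : ℝ) := rfl
      _ ≤ (1 - 1 / ((k : ℝ) + 1)) := mul_le_of_le_one_right (hcmem k).1 (w e).2.2
      _ < 1 := hc
  have hc_lim : Tendsto (fun k : ℕ => (1 : ℝ) - 1 / ((k : ℝ) + 1)) atTop (𝓝 1) := by
    simpa using tendsto_const_nhds.sub (tendsto_one_div_add_atTop_nhds_zero_nat (𝕜 := ℝ))
  have hwk_lim : Tendsto wk atTop (𝓝 w) := by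
    refine tendsto_pi_nhds.2 fun e => ?_
    rw [tendsto_subtype_rng]
    have h := hc_lim.mul_const (w e : ℝ)
    rw [one_mul] at h
    exact h
  have hlimE : ∀ E : Set (Set (Sym2 (Fin n))),
      Tendsto (fun k => (prodBernoulli (wk k)).real E) atTop (𝓝 ((prodBernoulli w).real E)) :=
    fun E => ((stub_weightContinuity n E).tendsto w).comp hwk_lim
  -- the error terms
  set δ : ℕ → ℝ := fun k =>
    (∑ u ∈ L, |(prodBernoulli (wk k)).real {ω | ∀ b ∈ far u, ω ∉ openConn u b} -
        (prodBernoulli w).real {ω | ∀ b ∈ far u, ω ∉ openConn u b}|) +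
      |(prodBernoulli (wk k)).real {ω | ∀ b ∈ B, ∀ b' ∈ A \ B, ω ∉ openConn b b'} -
        (prodBernoulli w).real {ω | ∀ b ∈ B, ∀ b' ∈ A \ B, ω ∉ openConn b b'}| with hδ_def
  have hδ0 : ∀ k, 0 ≤ δ k := fun k => add_nonneg (Finset.sum_nonneg fun u _ => abs_nonneg _) (abs_nonneg _)
  have hδ_lim : Tendsto δ atTop (𝓝 0) := by
    have h1 : ∀ u ∈ L, Tendsto (fun k =>
        |(prodBernoulli (wk k)).real {ω | ∀ b ∈ far u, ω ∉ openConn u b} -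
          (prodBernoulli w).real {ω | ∀ b ∈ far u, ω ∉ openConn u b}|) atTop (𝓝 0) := by
      intro u _
      simpa using (tendsto_sub_nhds_zero_iff.2 (hlimE {ω | ∀ b ∈ far u, ω ∉ openConn u b})).abs
    have h2 : Tendsto (fun k =>
        |(prodBernoulli (wk k)).real {ω | ∀ b ∈ B, ∀ b' ∈ A \ B, ω ∉ openConn b b'} -
          (prodBernoulli w).real {ω | ∀ b ∈ B, ∀ b' ∈ A \ B, ω ∉ openConn b b'}|) atTop (𝓝 0) := by
      simpa using (tendsto_sub_nhds_zero_iff.2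
        (hlimE {ω | ∀ b ∈ B, ∀ b' ∈ A \ B, ω ∉ openConn b b'})).abs
    simpa [hδ_def] using (tendsto_finsetSum L h1).add h2
  -- the bound at each `k`
  have hk : ∀ k, (prodBernoulli (wk k)).real {ω | A.filter (fun a => ω ∈ openConn o a) = B ∨
      A.filter (fun a => ω ∈ openConn o a) = A \ B ∨
      ∃ r ∈ L, A.filter (fun a => ω ∈ openConn o a) = {r}} ≤ t + δ k := by
    intro k
    refine twoLevel_pos (wk k) A B L far o (t + δ k) hBA hL
      (singleFinger_pairSep_real_pos (wk k) (hwk_lt k) A) ?_ ?_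
    · intro u hu
      have h1 := hK u hu
      have h2 : |(prodBernoulli (wk k)).real {ω | ∀ b ∈ far u, ω ∉ openConn u b} -
            (prodBernoulli w).real {ω | ∀ b ∈ far u, ω ∉ openConn u b}| ≤ δ k := by
        have h3 := Finset.single_le_sum (f := fun u =>
          |(prodBernoulli (wk k)).real {ω | ∀ b ∈ far u, ω ∉ openConn u b} -
            (prodBernoulli w).real {ω | ∀ b ∈ far u, ω ∉ openConn u b}|)
          (fun u _ => abs_nonneg _) hu
        simp only [hδ_def]
        linarith [abs_nonneg ((prodBernoulli (wk k)).real {ω | ∀ b ∈ B, ∀ b' ∈ A \ B, ω ∉ openConn b b'} -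
          (prodBernoulli w).real {ω | ∀ b ∈ B, ∀ b' ∈ A \ B, ω ∉ openConn b b'})]
      have h4 := le_abs_self ((prodBernoulli (wk k)).real {ω | ∀ b ∈ far u, ω ∉ openConn u b} -
          (prodBernoulli w).real {ω | ∀ b ∈ far u, ω ∉ openConn u b})
      linarith
    · have h2 : |(prodBernoulli (wk k)).real {ω | ∀ b ∈ B, ∀ b' ∈ A \ B, ω ∉ openConn b b'} -
            (prodBernoulli w).real {ω | ∀ b ∈ B, ∀ b' ∈ A \ B, ω ∉ openConn b b'}| ≤ δ k := by
        simp only [hδ_def]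
        linarith [Finset.sum_nonneg (s := L) (f := fun u =>
          |(prodBernoulli (wk k)).real {ω | ∀ b ∈ far u, ω ∉ openConn u b} -
            (prodBernoulli w).real {ω | ∀ b ∈ far u, ω ∉ openConn u b}|) (fun u _ => abs_nonneg _)]
      have h4 := le_abs_self ((prodBernoulli (wk k)).real {ω | ∀ b ∈ B, ∀ b' ∈ A \ B, ω ∉ openConn b b'} -
          (prodBernoulli w).real {ω | ∀ b ∈ B, ∀ b' ∈ A \ B, ω ∉ openConn b b'})
      linarith
  -- pass to the limit
  have hlimt : Tendsto (fun k => t + δ k) atTop (𝓝 t) := by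
    simpa using tendsto_const_nhds.add hδ_lim
  exact le_of_tendsto_of_tendsto' (hlimE _) hlimt hk

end TwoLevelLonelyRelay

open TwoLevelLonelyRelay in
/-- **THE TWO-LEVEL LONELY RELAY THEOREM** (all `|A|`, unconditional).  Bond percolation with arbitrary edge
probabilities on `Fin n`; an observer `o`; relays `A` split into two halves `B` and `A ∖ B`; designated singletons
`U ⊆ B`, `U' ⊆ A ∖ B`; `S = C(o) ∩ A` the set of relays joined to `o`.  If every designated `u` is cut from the
OTHER half with probability `≤ t` (`μ(u ↮ A∖B) ≤ t` for `u ∈ U`, `μ(u ↮ B) ≤ t` for `u ∈ U'`) and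
`μ(B ↮ A∖B) ≤ t`, then
  `μ( S = B  ∨  S = A∖B  ∨  S = {u} for some u ∈ U ∪ U' ) ≤ t`.
The two coarse blocks and all designated fine singletons TOGETHER carry at most one cut budget `t`: nested levels
of candidate pockets do not add up (Kozma–Nitzan's Lemma 2 gives `t` for each antichain separately).
`U = U' = ∅` is trivial, `B = ∅`-free singletons is the lonely relay lemma, `U = B`, `U' = A∖B` with
`|B| = |A∖B| = 2` is the dyadic `k = 4` instance (harness rows P3-LAM2X/W).  Proof: Kozma–Nitzan weights
`φ_u = P(o ↔ u | u ↮ A∖u)`; `Σ_u φ_u·(μ(u ↮ far u) − μ(Λ)) ≥ 0` by the loss bound (two-set BHK, negative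
correlation) and the gain bound (rider lemma + Lemma 2 on realised crossing blocks), which cancel in pairs.
[cite: KozmaNitzan2024, Lemma 2 (p. 6) and Theorem 1 (p. 7); VandenbergHaggstromKahn2005, Thm. 2.1 at q = 1] -/
theorem twoLevelLonelyRelay (n : ℕ) (w : Sym2 (Fin n) → unitInterval) (A B U U' : Finset (Fin n))
    (o : Fin n) (t : ℝ) (hBA : B ⊆ A) (hU : U ⊆ B) (hU' : U' ⊆ A \ B)
    (hKU : ∀ u ∈ U, (prodBernoulli w).real {ω | ∀ b ∈ A \ B, ω ∉ openConn u b} ≤ t)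
    (hKU' : ∀ u ∈ U', (prodBernoulli w).real {ω | ∀ b ∈ B, ω ∉ openConn u b} ≤ t)
    (hBB : (prodBernoulli w).real {ω | ∀ b ∈ B, ∀ b' ∈ A \ B, ω ∉ openConn b b'} ≤ t) :
    (prodBernoulli w).real {ω : Set (Sym2 (Fin n)) | A.filter (fun a => ω ∈ openConn o a) = B ∨
        A.filter (fun a => ω ∈ openConn o a) = A \ B ∨
        ∃ u ∈ U ∪ U', A.filter (fun a => ω ∈ openConn o a) = {u}} ≤ t := by
  refine twoLevel_far w A B (U ∪ U') (fun u => if u ∈ B then A \ B else B) o t hBA ?_ ?_ hBB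
  · intro r hr
    rcases Finset.mem_union.1 hr with hrU | hrU
    · exact Or.inl ⟨hU hrU, if_pos (hU hrU)⟩
    · exact Or.inr ⟨hU' hrU, if_neg (Finset.mem_sdiff.1 (hU' hrU)).2⟩
  · intro u hu
    rcases Finset.mem_union.1 hu with huU | huU
    · simp only [if_pos (hU huU)]; exact hKU u huU
    · simp only [if_neg (Finset.mem_sdiff.1 (hU' huU)).2]; exact hKU' u huU

/-- **Two-level lonely relay, pairwise form.**  If both halves are nonempty and `μ(a ↮ a') ≤ t` for all
distinct relays, then `μ(S = B ∨ S = A∖B ∨ S = {u}, u ∈ U ∪ U') ≤ t` — ONE pair-cut budget for the bipartition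
and all designated singletons together (`≤ max_{a≠a'} P(a ↮ a')`, the (LAM) bound for this laminar family).
[cite: KozmaNitzan2024, Lemma 2 (p. 6) — corollary] -/
theorem twoLevelLonelyRelay_of_pairs (n : ℕ) (w : Sym2 (Fin n) → unitInterval) (A B U U' : Finset (Fin n))
    (o : Fin n) (t : ℝ) (hBA : B ⊆ A) (hB : B.Nonempty) (hB' : (A \ B).Nonempty)
    (hU : U ⊆ B) (hU' : U' ⊆ A \ B)
    (hpair : ∀ a ∈ A, ∀ a' ∈ A, a ≠ a' → (prodBernoulli w).real (openConn a a')ᶜ ≤ t) :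
    (prodBernoulli w).real {ω : Set (Sym2 (Fin n)) | A.filter (fun a => ω ∈ openConn o a) = B ∨
        A.filter (fun a => ω ∈ openConn o a) = A \ B ∨
        ∃ u ∈ U ∪ U', A.filter (fun a => ω ∈ openConn o a) = {u}} ≤ t := by
  obtain ⟨b₀, hb₀⟩ := hB
  obtain ⟨b₁, hb₁⟩ := hB'
  have hb₁A : b₁ ∈ A := (Finset.mem_sdiff.1 hb₁).1
  have hb₁B : b₁ ∉ B := (Finset.mem_sdiff.1 hb₁).2
  refine twoLevelLonelyRelay n w A B U U' o t hBA hU hU' ?_ ?_ ?_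
  · intro u hu
    have hne : u ≠ b₁ := fun h => hb₁B (h ▸ hU hu)
    exact (measureReal_mono (fun ω hω => by
        simp only [Set.mem_setOf_eq, Set.mem_compl_iff] at hω ⊢; exact hω b₁ hb₁) (measure_ne_top _ _)).trans
      (hpair u (hBA (hU hu)) b₁ hb₁A hne)
  · intro u hu
    have huA : u ∈ A := (Finset.mem_sdiff.1 (hU' hu)).1
    have hne : u ≠ b₀ := fun h => (Finset.mem_sdiff.1 (hU' hu)).2 (h ▸ hb₀)
    exact (measureReal_mono (fun ω hω => by
        simp only [Set.mem_setOf_eq, Set.mem_compl_iff] at hω ⊢; exact hω b₀ hb₀) (measure_ne_top _ _)).trans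
      (hpair u huA b₀ (hBA hb₀) hne)
  · have hne : b₀ ≠ b₁ := fun h => hb₁B (h ▸ hb₀)
    exact (measureReal_mono (fun ω hω => by
        simp only [Set.mem_setOf_eq, Set.mem_compl_iff] at hω ⊢; exact hω b₀ hb₀ b₁ hb₁)
      (measure_ne_top _ _)).trans (hpair b₀ (hBA hb₀) b₁ hb₁A hne)

/-- **Halves-or-singleton form.**  For EVERY bipartition `A = B ⊔ (A∖B)` into nonempty halves and pairwise
`(1−t)`-reliable relays:  `μ( N = 1  ∨  S = B  ∨  S = A∖B ) ≤ t`  (`N = |S|`): the lonely-relay level and the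
top bipartition share one budget.  Equality: `o` glued to one relay, the other half glued together.
[cite: KozmaNitzan2024, Lemma 2 (p. 6) — corollary] -/
theorem twoLevelLonelyRelay_halves (n : ℕ) (w : Sym2 (Fin n) → unitInterval) (A B : Finset (Fin n))
    (o : Fin n) (t : ℝ) (hBA : B ⊆ A) (hB : B.Nonempty) (hB' : (A \ B).Nonempty)
    (hpair : ∀ a ∈ A, ∀ a' ∈ A, a ≠ a' → (prodBernoulli w).real (openConn a a')ᶜ ≤ t) :
    (prodBernoulli w).real {ω : Set (Sym2 (Fin n)) | A.filter (fun a => ω ∈ openConn o a) = B ∨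
        A.filter (fun a => ω ∈ openConn o a) = A \ B ∨
        ∃ u ∈ A, A.filter (fun a => ω ∈ openConn o a) = {u}} ≤ t := by
  have h := twoLevelLonelyRelay_of_pairs n w A B B (A \ B) o t hBA hB hB' subset_rfl subset_rfl hpair
  rw [Finset.union_sdiff_of_subset hBA] at h
  exact h

end Summit.CriticalPhenomena.PercolationContinuityZ3.Theorems
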